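import Literature.IUT.LogVolume.PacketBoxDepthStable
import Literature.IUT.LogVolume.IsometryStableStrictContraction
import HarnessLib

/-!
# Box depth of `(R_I)^∼`, converse direction: on a TWO-slot packet, single-slot isometry stability forces
# `(π ⊗ 1)·(R_I)^∼ ⊆ Box` — so at a slot with residue field `𝔽₂` the box-depth-`1` containment is a CRITERION

Classical local algebra (nothing disputed; the [IUTchIV] locator records where the abc-iut cell uses it).  Sequel of
`PacketBoxDepthStable` (abc-iut-E-t7): there, for a slot `i₀` with residue field `𝔽₂` and `π` dominating its open unit ball, the ONE
containment `(π ⊗ 1 ⊗ ⋯ ⊗ 1)·(R_I)^∼ ⊆ Box` implies that every `ℚ_p`-linear isometry at slot `i₀` fixes `(R_I)^∼` ([IUTchIV] Prop. 1.1's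
maximal order of the packet; Box = abc-iut-E-t58's monomial box of norm-dominated slot bases = the (PG)-span).  THIS FILE proves the
converse on TWO-slot packets (the shape of the cell's mixed table `K ⊗ L`), for ANY slot field and ANY `π` of norm `< 1`:

* §1 `box_of_mem_of_support` — PURITY: on a two-slot packet (`I` with exactly two indices `i₀ ≠ i₁`), an element `u ∈ (R_I)^∼` whose
  tensor-basis coordinates vanish off one slot-`i₀` index `m` (`u = b^{(i₀)}_m ⊗ y`) lies in Box: evaluating at `σ_{i₀} ⊗ σ_{i₁} : V → ℚ̄_p`
  gives `‖b_m‖·‖y‖ ≤ 1` (integrality), and domination of `b^{(i₁)}` bounds the coordinates of `y`.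
* §2 the strict contractions `F_m : x ↦ (π x)_m · b^{(i₀)}_m` (`‖F_m x‖ ≤ ‖π‖·‖x‖ < ‖x‖` by domination), `Σ_m F_m = (π·)`, and the support
  of `(F_m ⊗ 1) z` (coordinates vanish off the index `m`, E-t58's `repr_map_apply`).
* §3 **`mul_pi_box_of_single_isometry_stable`** — if every `ℚ_p`-linear isometry at slot `i₀` (identity at `i₁`) maps `(R_I)^∼` into
  `(R_I)^∼` (abc-iut-E-t20's single-slot stability binder), then `(π ⊗ 1)·(R_I)^∼ ⊆ Box`: by E-t20's `StrictContraction.map_update_mem_of_strict`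
  each `(F_m ⊗ 1) z` lies in `(R_I)^∼`, by §1 in Box, and `(π ⊗ 1) z = Σ_m (F_m ⊗ 1) z`.
* §4 **`single_isometry_stable_iff_mul_pi_box`** — at a slot with residue field `𝔽₂` (units `≡ 1`, `π` dominating the open unit ball) of a
  two-slot packet: «every isometry at `i₀` fixes `(R_I)^∼`» ⟺ «`(π ⊗ 1)·(R_I)^∼ ⊆ Box`» (⟸ = `BoxDepth.map_mem_normalizedPacket_of_mul_pi_box`).
  This is the BOX-DEPTH CRITERION of the abc-iut cell's exact mixed-packet table (abc-iut-E-t7 memo §7: it reproduces the 70 slot verdicts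
  of the 35 dyadic packets, e.g. `ℚ₂(√2) ⊗ ℚ₂(√−2)` stable / `ℚ₂(√2) ⊗ ℚ₂(√10)` moved / `ℚ₂(ζ₈) ⊗ ℚ₂(√−1)` moved by the `ζ₈`-slot); the AMPLE
  slots (`p` odd or `f ≥ 2`: «stable ⟺ (R_I)^∼ = Box») are abc-iut-E-t9's `IsometryStablePureTensorCriterionAmple`, the operator form of
  the `𝔽₂` case is abc-iut-E-t20's `IsometryStableStrictContraction`.

Statement about CONTAINERS only; it takes no side on [IUTchIII] Cor. 3.12.  PROOF-ONLY file (theorems, no definitions, no `Prop` facts,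
no `sorry`).
[cite: Mochizuki2012, IUTchIV Prop. 1.1 p. 9] [cite: WeilBNT1967, Ch. II §1, Prop. 3] [cite: SerreLocalFields1979, Ch. III §3, Prop. 7]
[cite: NeukirchANT1999, Ch. II (4.8)]
-/

noncomputable section

open Module Function

namespace Literature.IUT.LogVolume

namespace BoxDepth

section TwoSlots

variable (p : ℕ) [hp : Fact p.Prime] {I : Type} [Fintype I] [DecidableEq I]
  (k : I → Type) [∀ i, NontriviallyNormedField (k i)] [∀ i, NormedAlgebra ℚ_[p] (k i)]
  [∀ i, IsUltrametricDist (k i)] [∀ i, ProperSpace (k i)]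
variable {κ : I → Type} [∀ i, Fintype (κ i)] (b : ∀ i, Basis (κ i) ℚ_[p] (k i))

/-! ## §0 Two-element index types -/

omit hp [Fintype I] [DecidableEq I] [∀ i, NontriviallyNormedField (k i)] [∀ i, NormedAlgebra ℚ_[p] (k i)]
  [∀ i, IsUltrametricDist (k i)] [∀ i, ProperSpace (k i)] [∀ i, Fintype (κ i)] in
/-- On an index type with exactly the two elements `i₀ ≠ i₁`, a multi-index is determined by its two components.
[cite: Mochizuki2012, IUTchIV Prop. 1.1 p. 9] -/
theorem multiIndex_ext {i₀ i₁ : I} (hI : ∀ i, i = i₀ ∨ i = i₁) {J J' : Π i, κ i}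
    (h₀ : J i₀ = J' i₀) (h₁ : J i₁ = J' i₁) : J = J' := by
  funext i
  rcases hI i with rfl | rfl
  · exact h₀
  · exact h₁

omit hp [DecidableEq I] [∀ i, NontriviallyNormedField (k i)] [∀ i, NormedAlgebra ℚ_[p] (k i)] [∀ i, IsUltrametricDist (k i)]
  [∀ i, ProperSpace (k i)] [∀ i, Fintype (κ i)] in
/-- `∏_i f i = f i₀ · f i₁` on an index type with exactly the two elements `i₀ ≠ i₁`. [cite: Mochizuki2012, IUTchIV Prop. 1.1 p. 9] -/
theorem prod_two {M : Type*} [CommMonoid M] {i₀ i₁ : I} (hne : i₀ ≠ i₁) (hI : ∀ i, i = i₀ ∨ i = i₁) (f : I → M) :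
    ∏ i, f i = f i₀ * f i₁ := by
  classical
  have huniv : (Finset.univ : Finset I) = {i₀, i₁} := by
    ext i
    simp only [Finset.mem_univ, Finset.mem_insert, Finset.mem_singleton, true_iff]
    exact hI i
  rw [huniv, Finset.prod_pair hne]

/-! ## §1 Purity: a slot-`i₀`-monomial-supported element of `(R_I)^∼` of a two-slot packet lies in Box -/

/-- **PURITY.**  Two slots `i₀ ≠ i₁`; `b^{(i₁)}` norm-dominated.  If `u ∈ (R_I)^∼` has tensor-basis coordinates supported on the multi-indices
`J` with `J i₀ = m` (i.e. `u = b^{(i₀)}_m ⊗ y`, `y = Σ_J u_J·b^{(i₁)}_{J i₁}`), then `u` has box coordinates: `Φ = ⊗σ_i` sends `u` to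
`σ_{i₀}(b_m)·σ_{i₁}(y)`, integral hence of norm `≤ 1`, so `‖b_m‖·‖y‖ ≤ 1`; and `‖u_J·b^{(i₁)}_{J i₁}‖ ≤ ‖y‖` by domination.
[cite: Mochizuki2012, IUTchIV Prop. 1.1 p. 9] [cite: WeilBNT1967, Ch. II §1, Prop. 3] [cite: NeukirchANT1999, Ch. II (4.8)] -/
theorem box_of_mem_of_support {i₀ i₁ : I} (hne : i₀ ≠ i₁) (hI : ∀ i, i = i₀ ∨ i = i₁)
    (hdom₁ : ∀ (x : k i₁) (n : κ i₁), ‖(b i₁).repr x n • b i₁ n‖ ≤ ‖x‖) (m : κ i₀)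
    {u : PacketAlgebra p k} (hu : u ∈ normalizedPacket p k)
    (hsupp : ∀ J : Π i, κ i, J i₀ ≠ m → (Basis.piTensorProduct b).repr u J = 0) (J : Π i, κ i) :
    ‖(Basis.piTensorProduct b).repr u J‖ * ∏ i, ‖b i (J i)‖ ≤ 1 := by
  classical
  haveI : Nonempty I := ⟨i₀⟩
  by_cases hJ : J i₀ = m
  swap
  · rw [hsupp J hJ, norm_zero, zero_mul]; exact zero_le_one
  -- the element `y = Σ_J u_J · b^{(i₁)}_{J i₁}` of the slot `i₁`
  set c : (Π i, κ i) → ℚ_[p] := fun J' => (Basis.piTensorProduct b).repr u J' with hc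
  set y : k i₁ := ∑ J', c J' • b i₁ (J' i₁) with hy
  -- (1) `‖b_m‖ · ‖y‖ ≤ 1` by evaluation at `⊗σ_i`
  have σ : ∀ i, k i →ₐ[ℚ_[p]] PadicAlgCl p := fun i => Classical.choice EmbeddingOrder.nonempty_algHom_padicAlgCl
  obtain ⟨Φ, hΦ⟩ := exists_algHom_of_algHom p k σ
  have hint : ‖Φ u‖ ≤ 1 :=
    (Literature.NumberTheory.GaloisRepresentations.PadicAlgCl.norm_le_one_iff_isIntegral _).mpr
      ((isIntegral_of_mem_normalizedPacket p k hu).map (Φ.restrictScalars ℤ_[p]))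
  have hterm : ∀ J', c J' • (∏ i, σ i (b i (J' i))) = σ i₀ (b i₀ m) * (c J' • σ i₁ (b i₁ (J' i₁))) := by
    intro J'
    by_cases hJ' : J' i₀ = m
    · rw [prod_two hne hI, hJ', mul_smul_comm]
    · rw [show c J' = 0 from hsupp J' hJ', zero_smul, zero_smul, mul_zero]
  have hexp : Φ u = σ i₀ (b i₀ m) * σ i₁ y := by
    conv_lhs => rw [← (Basis.piTensorProduct b).sum_repr u]
    rw [map_sum, hy, map_sum, Finset.mul_sum]
    refine Finset.sum_congr rfl fun J' _ => ?_
    rw [map_smul, Basis.piTensorProduct_apply, ← purePacket, hΦ, hterm, map_smul]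
  have hby : ‖b i₀ m‖ * ‖y‖ ≤ 1 := by
    rw [hexp, norm_mul, norm_map_algHom, norm_map_algHom] at hint
    exact hint
  -- (2) the `i₁`-coordinate of `y` at `J i₁` is `u_J`
  have hcoord : (b i₁).repr y (J i₁) = c J := by
    rw [hy, map_sum, Finsupp.finsetSum_apply]
    rw [Finset.sum_eq_single J]
    · rw [map_smul, Basis.repr_self, Finsupp.smul_apply, Finsupp.single_apply, if_pos rfl, smul_eq_mul, mul_one]
    · intro J' _ hJ'J
      rw [map_smul, Basis.repr_self, Finsupp.smul_apply, Finsupp.single_apply]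
      by_cases h₁ : J' i₁ = J i₁
      · have h₀ : J' i₀ ≠ m := fun h₀ => hJ'J (multiIndex_ext hI (h₀.trans hJ.symm) h₁)
        rw [show c J' = 0 from hsupp J' h₀, zero_smul]
      · rw [if_neg h₁, smul_zero]
    · intro h; exact absurd (Finset.mem_univ J) h
  -- (3) conclude
  have hdomJ : ‖c J • b i₁ (J i₁)‖ ≤ ‖y‖ := by rw [← hcoord]; exact hdom₁ y (J i₁)
  calc ‖c J‖ * ∏ i, ‖b i (J i)‖ = ‖b i₀ m‖ * ‖c J • b i₁ (J i₁)‖ := by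
        rw [prod_two hne hI, hJ, norm_smul]; ring
    _ ≤ ‖b i₀ m‖ * ‖y‖ := mul_le_mul_of_nonneg_left hdomJ (norm_nonneg _)
    _ ≤ 1 := hby

/-! ## §2 The strict contractions `F_m : x ↦ (π x)_m · b_m` -/

omit [Fintype I] [DecidableEq I] [∀ i, IsUltrametricDist (k i)] [∀ i, ProperSpace (k i)] [∀ i, Fintype (κ i)] in
/-- `F_m := x ↦ (π x)_m · b^{(i₀)}_m` is a STRICT contraction when `b^{(i₀)}` is dominated and `‖π‖ < 1`: `‖F_m x‖ ≤ ‖π x‖ = ‖π‖·‖x‖ < ‖x‖`.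
[cite: WeilBNT1967, Ch. II §1, Prop. 3] -/
theorem coordProj_mul_strict (i₀ : I) (hdom₀ : ∀ (x : k i₀) (m : κ i₀), ‖(b i₀).repr x m • b i₀ m‖ ≤ ‖x‖)
    (π : k i₀) (hπ : ‖π‖ < 1) (m : κ i₀) (x : k i₀) (hx : x ≠ 0) :
    ‖((LinearMap.toSpanSingleton ℚ_[p] (k i₀) (b i₀ m) ∘ₗ (b i₀).coord m) ∘ₗ LinearMap.mulLeft ℚ_[p] π) x‖ < ‖x‖ := by
  have hxpos : 0 < ‖x‖ := norm_pos_iff.mpr hx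
  calc ‖((LinearMap.toSpanSingleton ℚ_[p] (k i₀) (b i₀ m) ∘ₗ (b i₀).coord m) ∘ₗ LinearMap.mulLeft ℚ_[p] π) x‖
      = ‖(b i₀).repr (π * x) m • b i₀ m‖ := by
        simp [LinearMap.comp_apply, LinearMap.mulLeft_apply, LinearMap.toSpanSingleton_apply, Basis.coord_apply]
    _ ≤ ‖π * x‖ := hdom₀ _ _
    _ = ‖π‖ * ‖x‖ := norm_mul _ _
    _ < 1 * ‖x‖ := mul_lt_mul_of_pos_right hπ hxpos
    _ = ‖x‖ := one_mul _

omit [Fintype I] [∀ i, IsUltrametricDist (k i)] [∀ i, ProperSpace (k i)] [∀ i, Fintype (κ i)] in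
/-- `Σ_{m ∈ s} F_m^{[i₀]} = (Σ_{m ∈ s} F_m)^{[i₀]}` for any finite family of slot maps (multilinearity of `⊗` in slot `i₀`, iterating
abc-iut-E-t20's `StrictContraction.map_update_add`). [cite: Mochizuki2012, IUTchIV Prop. 1.1 p. 9] -/
theorem map_update_sum (i₀ : I) {α : Type} (s : Finset α) (F : α → (k i₀ →ₗ[ℚ_[p]] k i₀)) :
    (PiTensorProduct.map (update (fun j => (LinearMap.id : k j →ₗ[ℚ_[p]] k j)) i₀ (∑ a ∈ s, F a)) :
        PacketAlgebra p k →ₗ[ℚ_[p]] PacketAlgebra p k) =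
      ∑ a ∈ s, PiTensorProduct.map (update (fun j => (LinearMap.id : k j →ₗ[ℚ_[p]] k j)) i₀ (F a)) := by
  classical
  induction s using Finset.induction_on with
  | empty =>
    rw [Finset.sum_empty, Finset.sum_empty]
    have h := StrictContraction.map_update_add p k i₀ (0 : k i₀ →ₗ[ℚ_[p]] k i₀) 0
    rw [add_zero] at h
    exact left_eq_add.mp h
  | insert a s ha ih => rw [Finset.sum_insert ha, Finset.sum_insert ha, StrictContraction.map_update_add, ih]

omit [Fintype I] [DecidableEq I] [∀ i, IsUltrametricDist (k i)] [∀ i, ProperSpace (k i)] in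
/-- `Σ_m F_m = (π·)`: `Σ_m (π x)_m · b_m = π x`. [cite: WeilBNT1967, Ch. II §1, Prop. 3] -/
theorem sum_coordProj_mul (i₀ : I) (π : k i₀) :
    ∑ m, (LinearMap.toSpanSingleton ℚ_[p] (k i₀) (b i₀ m) ∘ₗ (b i₀).coord m) ∘ₗ LinearMap.mulLeft ℚ_[p] π =
      LinearMap.mulLeft ℚ_[p] π := by
  ext x
  simp only [LinearMap.coe_sum, Finset.sum_apply, LinearMap.comp_apply, LinearMap.mulLeft_apply,
    LinearMap.toSpanSingleton_apply, Basis.coord_apply]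
  exact (b i₀).sum_repr (π * x)

omit [∀ i, IsUltrametricDist (k i)] [∀ i, ProperSpace (k i)] in
/-- **Support of `(F_m ⊗ 1) z`**: its tensor-basis coordinates vanish at every multi-index `J` with `J i₀ ≠ m` (E-t58's `repr_map_apply`: the
slot-`i₀` factor is `(b_{J' i₀})`'s image coordinate at `J i₀`, and `F_m` takes values in `ℚ_p·b_m`). [cite: Mochizuki2012, IUTchIV Prop. 1.1 p. 9] -/
theorem repr_map_coordProj_eq_zero (i₀ : I) (π : k i₀) (m : κ i₀) (z : PacketAlgebra p k) (J : Π i, κ i) (hJ : J i₀ ≠ m) :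
    (Basis.piTensorProduct b).repr (PiTensorProduct.map
        (update (fun j => (LinearMap.id : k j →ₗ[ℚ_[p]] k j)) i₀
          ((LinearMap.toSpanSingleton ℚ_[p] (k i₀) (b i₀ m) ∘ₗ (b i₀).coord m) ∘ₗ LinearMap.mulLeft ℚ_[p] π)) z) J = 0 := by
  classical
  rw [MonomialBox.repr_map_apply]
  refine Finset.sum_eq_zero fun J' _ => ?_
  have hfac : (b i₀).repr ((update (fun j => (LinearMap.id : k j →ₗ[ℚ_[p]] k j)) i₀
      ((LinearMap.toSpanSingleton ℚ_[p] (k i₀) (b i₀ m) ∘ₗ (b i₀).coord m) ∘ₗ LinearMap.mulLeft ℚ_[p] π) i₀)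
        (b i₀ (J' i₀))) (J i₀) = 0 := by
    rw [update_self]
    simp only [LinearMap.comp_apply, LinearMap.mulLeft_apply, LinearMap.toSpanSingleton_apply, Basis.coord_apply,
      map_smul, Basis.repr_self, Finsupp.smul_apply, Finsupp.single_apply, if_neg (Ne.symm hJ), smul_zero]
  rw [Finset.prod_eq_zero (Finset.mem_univ i₀) hfac, mul_zero]

/-! ## §3 Single-slot isometry stability ⟹ `(π ⊗ 1)·(R_I)^∼ ⊆ Box` -/

/-- **CONVERSE (two slots, any slot field, any `π` of norm `< 1`).**  Two slots `i₀ ≠ i₁` with norm-dominated bases.  If every `ℚ_p`-linear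
isometry at slot `i₀` (identity at `i₁`) maps `(R_I)^∼` into `(R_I)^∼` (abc-iut-E-t20's single-slot stability binder), then for every
`z ∈ (R_I)^∼` the element `(π at i₀ ⊗ 1) z` has box coordinates — i.e. `(π ⊗ 1)·(R_I)^∼ ⊆ Box`.  Proof: `(π ⊗ 1) z = Σ_m (F_m ⊗ 1) z`, each
`(F_m ⊗ 1) z ∈ (R_I)^∼` by E-t20's `StrictContraction.map_update_mem_of_strict` (`F_m` strict), each supported on the slot-`i₀` index `m`, hence
in Box by §1; at a multi-index `J` only the term `m = J i₀` contributes.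
[cite: Mochizuki2012, IUTchIV Prop. 1.1 p. 9] [cite: WeilBNT1967, Ch. II §1, Prop. 3] [cite: SerreLocalFields1979, Ch. III §3, Prop. 7] -/
theorem mul_pi_box_of_single_isometry_stable {i₀ i₁ : I} (hne : i₀ ≠ i₁) (hI : ∀ i, i = i₀ ∨ i = i₁)
    (hdom : ∀ i (x : k i) (m : κ i), ‖(b i).repr x m • b i m‖ ≤ ‖x‖)
    (π : k i₀) (hπ : ‖π‖ < 1)
    (h : ∀ u : k i₀ ≃ₗ[ℚ_[p]] k i₀, (∀ x, ‖u x‖ = ‖x‖) → ∀ z ∈ normalizedPacket p k,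
      PiTensorProduct.map (update (fun j => (LinearMap.id : k j →ₗ[ℚ_[p]] k j)) i₀ (u : k i₀ →ₗ[ℚ_[p]] k i₀)) z ∈
        normalizedPacket p k)
    {z : PacketAlgebra p k} (hz : z ∈ normalizedPacket p k) (J : Π i, κ i) :
    ‖(Basis.piTensorProduct b).repr (PiTensorProduct.map
        (update (fun j => (LinearMap.id : k j →ₗ[ℚ_[p]] k j)) i₀ (LinearMap.mulLeft ℚ_[p] π)) z) J‖ *
      ∏ i, ‖b i (J i)‖ ≤ 1 := by
  classical
  -- the strict contractions `F_m` and the decomposition `(π ⊗ 1) z = Σ_m (F_m ⊗ 1) z`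
  set F : κ i₀ → (k i₀ →ₗ[ℚ_[p]] k i₀) := fun m =>
    (LinearMap.toSpanSingleton ℚ_[p] (k i₀) (b i₀ m) ∘ₗ (b i₀).coord m) ∘ₗ LinearMap.mulLeft ℚ_[p] π with hF
  have hmem : ∀ m, PiTensorProduct.map (update (fun j => (LinearMap.id : k j →ₗ[ℚ_[p]] k j)) i₀ (F m)) z ∈
      normalizedPacket p k := fun m =>
    StrictContraction.map_update_mem_of_strict p k i₀ h (F m) (coordProj_mul_strict p k b i₀ (hdom i₀) π hπ m) hz
  have hdec : PiTensorProduct.map (update (fun j => (LinearMap.id : k j →ₗ[ℚ_[p]] k j)) i₀ (LinearMap.mulLeft ℚ_[p] π)) z =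
      ∑ m, PiTensorProduct.map (update (fun j => (LinearMap.id : k j →ₗ[ℚ_[p]] k j)) i₀ (F m)) z := by
    rw [← sum_coordProj_mul p k b i₀ π, map_update_sum, LinearMap.coe_sum, Finset.sum_apply]
  -- at the multi-index `J` only `m = J i₀` contributes
  have hcoordJ : (Basis.piTensorProduct b).repr (PiTensorProduct.map
      (update (fun j => (LinearMap.id : k j →ₗ[ℚ_[p]] k j)) i₀ (LinearMap.mulLeft ℚ_[p] π)) z) J =
      (Basis.piTensorProduct b).repr (PiTensorProduct.map
        (update (fun j => (LinearMap.id : k j →ₗ[ℚ_[p]] k j)) i₀ (F (J i₀))) z) J := by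
    rw [hdec, map_sum, Finsupp.finsetSum_apply, Finset.sum_eq_single (J i₀)]
    · intro m _ hm
      exact repr_map_coordProj_eq_zero p k b i₀ π m z J (Ne.symm hm)
    · intro hJ; exact absurd (Finset.mem_univ _) hJ
  rw [hcoordJ]
  exact box_of_mem_of_support p k b hne hI (hdom i₁) (J i₀) (hmem (J i₀))
    (fun J' hJ' => repr_map_coordProj_eq_zero p k b i₀ π (J i₀) z J' hJ') J

/-! ## §4 The box-depth CRITERION at a residue-field-`𝔽₂` slot of a two-slot packet -/

/-- **BOX-DEPTH CRITERION (two slots, slot `i₀` with residue field `𝔽₂`).**  Two slots `i₀ ≠ i₁` with norm-dominated bases, slot `i₀` with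
all units `≡ 1` (`‖w‖ = 1 → ‖w − 1‖ < 1`) and `π` dominating its open unit ball (`‖y‖ < 1 → ‖y‖ ≤ ‖π‖`, `‖π‖ < 1`); the field at `i₁` is
ARBITRARY.  Then: every `ℚ_p`-linear ISOMETRY at slot `i₀` (identity at `i₁`) maps `(R_I)^∼` into `(R_I)^∼` **if and only if**
`(π ⊗ 1)·(R_I)^∼ ⊆ Box` (box coordinates of `(π at i₀ ⊗ 1) z` for every `z ∈ (R_I)^∼`).  `⟸`: `BoxDepth.map_mem_normalizedPacket_of_mul_pi_box`;
`⟹`: §3.  [cite: Mochizuki2012, IUTchIV Prop. 1.1 p. 9] [cite: SerreLocalFields1979, Ch. III §3, Prop. 7] [cite: WeilBNT1967, Ch. II §1, Prop. 3] -/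
theorem single_isometry_stable_iff_mul_pi_box {i₀ i₁ : I} (hne : i₀ ≠ i₁) (hI : ∀ i, i = i₀ ∨ i = i₁)
    (hdom : ∀ i (x : k i) (m : κ i), ‖(b i).repr x m • b i m‖ ≤ ‖x‖)
    (hres : ∀ w : k i₀, ‖w‖ = 1 → ‖w - 1‖ < 1) (π : k i₀) (hπmax : ∀ y : k i₀, ‖y‖ < 1 → ‖y‖ ≤ ‖π‖) (hπ : ‖π‖ < 1) :
    (∀ u : k i₀ ≃ₗ[ℚ_[p]] k i₀, (∀ x, ‖u x‖ = ‖x‖) → ∀ z ∈ normalizedPacket p k,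
        PiTensorProduct.map (update (fun j => (LinearMap.id : k j →ₗ[ℚ_[p]] k j)) i₀ (u : k i₀ →ₗ[ℚ_[p]] k i₀)) z ∈
          normalizedPacket p k) ↔
      ∀ z ∈ normalizedPacket p k, ∀ J : Π i, κ i,
        ‖(Basis.piTensorProduct b).repr (PiTensorProduct.map
            (update (fun j => (LinearMap.id : k j →ₗ[ℚ_[p]] k j)) i₀ (LinearMap.mulLeft ℚ_[p] π)) z) J‖ *
          ∏ i, ‖b i (J i)‖ ≤ 1 := by
  haveI : Nonempty I := ⟨i₀⟩
  constructor
  · intro h z hz J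
    exact mul_pi_box_of_single_isometry_stable p k b hne hI hdom π hπ h hz J
  · intro hπR u hu z hz
    -- the tuple `(u at i₀, refl at i₁)` and the single-slot map agree
    set g : ∀ i, k i ≃ₗ[ℚ_[p]] k i := fun i => if hi : i = i₀ then hi ▸ u else LinearEquiv.refl ℚ_[p] (k i) with hg
    have hg₀ : g i₀ = u := by rw [hg]; simp
    have hoff : ∀ i, i ≠ i₀ → g i = LinearEquiv.refl ℚ_[p] (k i) := fun i hi => by rw [hg]; simp [hi]
    have hfam : (fun i => (g i : k i →ₗ[ℚ_[p]] k i)) =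
        update (fun j => (LinearMap.id : k j →ₗ[ℚ_[p]] k j)) i₀ (u : k i₀ →ₗ[ℚ_[p]] k i₀) := by
      funext i
      by_cases hi : i = i₀
      · subst hi; rw [update_self, hg₀]
      · rw [update_of_ne hi, hoff i hi]; rfl
    have hgn : ∀ x, ‖g i₀ x‖ = ‖x‖ := fun x => by rw [hg₀]; exact hu x
    have key := map_mem_normalizedPacket_of_mul_pi_box p k b hdom i₀ hres π hπmax hπR g hgn hoff hz
    rwa [hfam] at key

/-- … in the currency of factorwise tuples: under the same hypotheses, «`(⊗g_i)((R_I)^∼) = (R_I)^∼` for every tuple `g` that is an isometry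
at `i₀` and the identity at `i₁`» ⟺ «`(π ⊗ 1)·(R_I)^∼ ⊆ Box`». [cite: Mochizuki2012, IUTchIV Prop. 1.1 p. 9] -/
theorem congr_image_eq_iff_mul_pi_box {i₀ i₁ : I} (hne : i₀ ≠ i₁) (hI : ∀ i, i = i₀ ∨ i = i₁)
    (hdom : ∀ i (x : k i) (m : κ i), ‖(b i).repr x m • b i m‖ ≤ ‖x‖)
    (hres : ∀ w : k i₀, ‖w‖ = 1 → ‖w - 1‖ < 1) (π : k i₀) (hπmax : ∀ y : k i₀, ‖y‖ < 1 → ‖y‖ ≤ ‖π‖) (hπ : ‖π‖ < 1) :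
    (∀ g : ∀ i, k i ≃ₗ[ℚ_[p]] k i, (∀ x, ‖g i₀ x‖ = ‖x‖) → (∀ i, i ≠ i₀ → g i = LinearEquiv.refl ℚ_[p] (k i)) →
        (PiTensorProduct.congr g : PacketAlgebra p k ≃ₗ[ℚ_[p]] PacketAlgebra p k) ''
            (normalizedPacket p k : Set (PacketAlgebra p k)) = normalizedPacket p k) ↔
      ∀ z ∈ normalizedPacket p k, ∀ J : Π i, κ i,
        ‖(Basis.piTensorProduct b).repr (PiTensorProduct.map
            (update (fun j => (LinearMap.id : k j →ₗ[ℚ_[p]] k j)) i₀ (LinearMap.mulLeft ℚ_[p] π)) z) J‖ *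
          ∏ i, ‖b i (J i)‖ ≤ 1 := by
  haveI : Nonempty I := ⟨i₀⟩
  constructor
  · intro h
    refine (single_isometry_stable_iff_mul_pi_box p k b hne hI hdom hres π hπmax hπ).mp fun u hu z hz => ?_
    set g : ∀ i, k i ≃ₗ[ℚ_[p]] k i := fun i => if hi : i = i₀ then hi ▸ u else LinearEquiv.refl ℚ_[p] (k i) with hg
    have hg₀ : g i₀ = u := by rw [hg]; simp
    have hoff : ∀ i, i ≠ i₀ → g i = LinearEquiv.refl ℚ_[p] (k i) := fun i hi => by rw [hg]; simp [hi]
    have hfam : (fun i => (g i : k i →ₗ[ℚ_[p]] k i)) =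
        update (fun j => (LinearMap.id : k j →ₗ[ℚ_[p]] k j)) i₀ (u : k i₀ →ₗ[ℚ_[p]] k i₀) := by
      funext i
      by_cases hi : i = i₀
      · subst hi; rw [update_self, hg₀]
      · rw [update_of_ne hi, hoff i hi]; rfl
    have hgn : ∀ x, ‖g i₀ x‖ = ‖x‖ := fun x => by rw [hg₀]; exact hu x
    have himg := h g hgn hoff
    have hmem : (PiTensorProduct.congr g : PacketAlgebra p k ≃ₗ[ℚ_[p]] PacketAlgebra p k) z ∈
        (PiTensorProduct.congr g : PacketAlgebra p k ≃ₗ[ℚ_[p]] PacketAlgebra p k) ''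
          (normalizedPacket p k : Set (PacketAlgebra p k)) := Set.mem_image_of_mem _ hz
    rw [himg] at hmem
    have h1 : (PiTensorProduct.congr g : PacketAlgebra p k ≃ₗ[ℚ_[p]] PacketAlgebra p k) z =
        PiTensorProduct.map (fun i => (g i : k i →ₗ[ℚ_[p]] k i)) z := rfl
    rw [h1, hfam] at hmem
    exact hmem
  · intro hπR g hg hoff
    exact congr_image_normalizedPacket_eq_of_mul_pi_box p k b hdom i₀ hres π hπmax hπR g hg hoff

end TwoSlots

end BoxDepth

end Literature.IUT.LogVolume

end
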